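import Summits.ValiantsHypothesis.ValiantsHypothesis.Theorems.BarrierLeverPartitionMinorsYOnlyFactor

/-!
# Route BarrierLever — item `ChowHitsPartitionMinorsR` (stmt-ValiantsHypothesis-21882):
# SHIFT CALCULUS — one affine factor acts on the partition matrix of a lower-set layout by the shift
# operators; pure-`x` and pure-`y` factors are unipotent, hence FREE (they never change the determinant)

Helper file (`--supports stmt-ValiantsHypothesis-21882`; cell valiant-natproofs, rung V4, 𝒟-side support item of route
BarrierLever; prover seat val-np-p5 gen 32; seat memo MEMO-21882-valnp5-g32.md §2 «EXACT MD CALCULUS», step (a)–(b)).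
Closes NO item.

SETTING. A layout `u w : Fin r → Finset (Fin h)` whose row family and column family are injective LOWER SETS (every
`(u i).erase a` is again a row, every `(w j).erase c` again a column). `pmat u w f` is the partition matrix
`[coeff_{x^{u i} y^{w j}} f]_{i j}` of a polynomial `f` (the item's matrix when `f = ∏ ℓ_k`).

* `rowOp u α` = `Σ_a α_a A_a` where `A_a` moves row `(u i).erase a` to row `u i`; `colOp w b` = `Σ_c b_c B_c` likewise on
  columns. **`pmat_mul_affine`**: for an affine form `ℓ = c₀ + Σ_a α_a x_a + Σ_c b_c y_c`,
  `pmat (f·ℓ) = c₀ • pmat f + rowOp α · pmat f + pmat f · colOp b`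
  (`ChowFactor.coeff_partitionExpo_mul_affine`, p… of val-np-p4, in matrix form); for `c₀ = 1`:
  `pmat (f·ℓ) = (1 + rowOp α) · pmat f · (1 + colOp b) − rowOp α · pmat f · colOp b` (`pmat_mul_affine_one`).
* `1 + rowOp α` and `1 + colOp b` are BLOCK-UNIPOTENT for the grading by cardinality, so
  `det (1 + rowOp α) = 1 = det (1 + colOp b)` (`det_one_add_rowOp`, `det_one_add_colOp`).
* **PURE FORMS ARE FREE**: `det pmat (f · (1 + Σ_a α_a x_a)) = det pmat f` (`det_pmat_mul_pureX`), the same for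
  `1 + Σ_c b_c y_c` (`det_pmat_mul_pureY`), and for any product of pure forms (`det_pmat_mul_prod_pureX/Y`). Consequently a
  design hits a lower-set layout iff the design obtained by deleting all its pure forms does; only MIXED forms
  `1 + L(x) + N(y)` (`L, N ≠ 0`) carry information, and each acts by `P ↦ (1+L)P(1+N) − LPN` — the algebraic core of the
  matching design MD (`…ChowHitsPartitionMinorsRMatchingDesign`, p729761) and of the seat memo's normal form
  `𝕄 = Σ_K (−1)^{|K|} L̃_K E Ñ_K`.

WHAT THIS IS NOT: item 21882 is NOT proved; CONJECTURE MD is NOT proved; nothing on crux stmt-ValiantsHypothesis-14610 or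
on `VP` versus `VNP`.
-/

set_option linter.dupNamespace false

namespace Summit.ValiantsHypothesis.ValiantsHypothesis.Theorems.BarrierLever.ChowShift

open Finset MvPolynomial
open Summit.ValiantsHypothesis.ValiantsHypothesis.Theorems.BarrierLever.ChowFactor (coeff_partitionExpo_mul_affine)

noncomputable section

variable {h r : ℕ} {S : Type*} [CommRing S]

/-! ## 1. The partition matrix and the shift operators -/

/-- **Partition matrix** of `f` on the layout `(u, w)`: entry `(i, j)` is the coefficient of `x^{u i} y^{w j}`. -/
def pmat (u w : Fin r → Finset (Fin h)) (f : MvPolynomial (Fin (h + h)) S) : Matrix (Fin r) (Fin r) S :=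
  Matrix.of fun i j => coeff (∑ a ∈ u i, Finsupp.single (Fin.castAdd h a) 1 +
    ∑ c ∈ w j, Finsupp.single (Fin.natAdd h c) 1) f

/-- **Row shift operator** `Σ_a α_a A_a`: entry `(i, i')` is `α_a` when `u i' = (u i).erase a` for some `a ∈ u i`. -/
def rowOp (u : Fin r → Finset (Fin h)) (α : Fin h → S) : Matrix (Fin r) (Fin r) S :=
  Matrix.of fun i i' => ∑ a ∈ u i, if u i' = (u i).erase a then α a else 0

/-- **Column shift operator** `Σ_c b_c B_c`: entry `(j', j)` is `b_c` when `w j' = (w j).erase c` for some `c ∈ w j`. -/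
def colOp (w : Fin r → Finset (Fin h)) (b : Fin h → S) : Matrix (Fin r) (Fin r) S :=
  Matrix.of fun j' j => ∑ c ∈ w j, if w j' = (w j).erase c then b c else 0

/-- Entries of the partition matrix. -/
theorem pmat_apply (u w : Fin r → Finset (Fin h)) (f : MvPolynomial (Fin (h + h)) S) (i j : Fin r) :
    pmat u w f i j = coeff (∑ a ∈ u i, Finsupp.single (Fin.castAdd h a) 1 +
      ∑ c ∈ w j, Finsupp.single (Fin.natAdd h c) 1) f := rfl

/-- A sum of an indicator of a value taken exactly once (injective family) picks that index. -/
theorem sum_ite_eq_of_injective {u : Fin r → Finset (Fin h)} (hu : Function.Injective u)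
    {T : Finset (Fin h)} {i₀ : Fin r} (hi₀ : u i₀ = T) (x : S) (g : Fin r → S) :
    (∑ i', (if u i' = T then x else 0) * g i') = x * g i₀ := by
  rw [Finset.sum_eq_single i₀]
  · rw [if_pos hi₀]
  · intro i' _ hne
    rw [if_neg (fun e => hne (hu (e.trans hi₀.symm))), zero_mul]
  · intro hn; exact absurd (Finset.mem_univ _) hn

/-- Column version of `sum_ite_eq_of_injective`. -/
theorem sum_mul_ite_eq_of_injective {w : Fin r → Finset (Fin h)} (hw : Function.Injective w)
    {T : Finset (Fin h)} {j₀ : Fin r} (hj₀ : w j₀ = T) (x : S) (g : Fin r → S) :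
    (∑ j', g j' * (if w j' = T then x else 0)) = x * g j₀ := by
  rw [Finset.sum_eq_single j₀]
  · rw [if_pos hj₀, mul_comm]
  · intro j' _ hne
    rw [if_neg (fun e => hne (hw (e.trans hj₀.symm))), mul_zero]
  · intro hn; exact absurd (Finset.mem_univ _) hn

/-- In a lower-set family every one-element deletion of a member is a member. -/
theorem exists_erase_of_isLowerSet {u : Fin r → Finset (Fin h)} (hlu : IsLowerSet (Set.range u))
    (i : Fin r) (a : Fin h) : ∃ i', u i' = (u i).erase a := by
  obtain ⟨i', hi'⟩ := hlu (Finset.erase_subset a (u i)) ⟨i, rfl⟩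
  exact ⟨i', hi'⟩

/-! ## 2. One affine factor in matrix form -/

section Affine

variable (u w : Fin r → Finset (Fin h)) (hu : Function.Injective u) (hw : Function.Injective w)
  (hlu : IsLowerSet (Set.range u)) (hlw : IsLowerSet (Set.range w))

include hu hlu in
/-- The row shift operator applied to a partition matrix: `(rowOp α · pmat f) i j = Σ_{a ∈ u i} α_a · coeff_{(u i − a, w j)} f`. -/
theorem rowOp_mul_pmat (α : Fin h → S) (f : MvPolynomial (Fin (h + h)) S) (i j : Fin r) :
    (rowOp u α * pmat u w f) i j = ∑ a ∈ u i, α a * coeff (∑ a' ∈ (u i).erase a, Finsupp.single (Fin.castAdd h a') 1 +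
      ∑ c ∈ w j, Finsupp.single (Fin.natAdd h c) 1) f := by
  rw [Matrix.mul_apply]
  simp only [rowOp, Matrix.of_apply, Finset.sum_mul]
  rw [Finset.sum_comm]
  refine Finset.sum_congr rfl fun a _ => ?_
  obtain ⟨i₀, hi₀⟩ := exists_erase_of_isLowerSet hlu i a
  rw [sum_ite_eq_of_injective hu hi₀, pmat_apply, hi₀]

include hw hlw in
/-- The column shift operator applied to a partition matrix: `(pmat f · colOp b) i j = Σ_{c ∈ w j} b_c · coeff_{(u i, w j − c)} f`. -/
theorem pmat_mul_colOp (b : Fin h → S) (f : MvPolynomial (Fin (h + h)) S) (i j : Fin r) :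
    (pmat u w f * colOp w b) i j = ∑ c ∈ w j, b c * coeff (∑ a ∈ u i, Finsupp.single (Fin.castAdd h a) 1 +
      ∑ c' ∈ (w j).erase c, Finsupp.single (Fin.natAdd h c') 1) f := by
  rw [Matrix.mul_apply]
  simp only [colOp, Matrix.of_apply, Finset.mul_sum]
  rw [Finset.sum_comm]
  refine Finset.sum_congr rfl fun c _ => ?_
  obtain ⟨j₀, hj₀⟩ := exists_erase_of_isLowerSet hlw j c
  rw [sum_mul_ite_eq_of_injective hw hj₀, pmat_apply, hj₀]

include hu hw hlu hlw in
/-- **ONE AFFINE FACTOR (matrix form).** For `ℓ = c₀ + Σ_a α_a x_a + Σ_c b_c y_c`: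
`pmat (f·ℓ) = c₀ • pmat f + rowOp α · pmat f + pmat f · colOp b`. -/
theorem pmat_mul_affine (f : MvPolynomial (Fin (h + h)) S) (c₀ : S) (α b : Fin h → S) :
    pmat u w (f * (C c₀ + ∑ a, C (α a) * X (Fin.castAdd h a) + ∑ c, C (b c) * X (Fin.natAdd h c))) =
      c₀ • pmat u w f + rowOp u α * pmat u w f + pmat u w f * colOp w b := by
  ext i j
  rw [Matrix.add_apply, Matrix.add_apply, Matrix.smul_apply, rowOp_mul_pmat u w hu hlu, pmat_mul_colOp u w hw hlw,
    pmat_apply, pmat_apply, coeff_partitionExpo_mul_affine, smul_eq_mul]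

include hu hw hlu hlw in
/-- **ONE AFFINE FACTOR with constant term `1`, as a unipotent sandwich minus a correction:**
`pmat (f·ℓ) = (1 + rowOp α) · pmat f · (1 + colOp b) − rowOp α · pmat f · colOp b`. The correction term is the whole
content of a MIXED form; it vanishes for pure forms. -/
theorem pmat_mul_affine_one (f : MvPolynomial (Fin (h + h)) S) (α b : Fin h → S) :
    pmat u w (f * (C 1 + ∑ a, C (α a) * X (Fin.castAdd h a) + ∑ c, C (b c) * X (Fin.natAdd h c))) =
      (1 + rowOp u α) * pmat u w f * (1 + colOp w b) - rowOp u α * pmat u w f * colOp w b := by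
  rw [pmat_mul_affine u w hu hw hlu hlw, one_smul]
  noncomm_ring

end Affine

/-! ## 3. The shift operators are block-unipotent -/

/-- An entry of `rowOp` between rows of equal or increasing size vanishes. -/
theorem rowOp_apply_eq_zero (u : Fin r → Finset (Fin h)) (α : Fin h → S) {i i' : Fin r}
    (hle : (u i).card ≤ (u i').card) : rowOp u α i i' = 0 := by
  simp only [rowOp, Matrix.of_apply]
  refine Finset.sum_eq_zero fun a ha => ?_
  rw [if_neg]
  intro e
  have := Finset.card_erase_of_mem ha
  rw [← e] at this
  have hpos : 0 < (u i).card := Finset.card_pos.mpr ⟨a, ha⟩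
  omega

/-- An entry of `colOp` between columns of equal or increasing size vanishes. -/
theorem colOp_apply_eq_zero (w : Fin r → Finset (Fin h)) (b : Fin h → S) {j' j : Fin r}
    (hle : (w j).card ≤ (w j').card) : colOp w b j' j = 0 := by
  simp only [colOp, Matrix.of_apply]
  refine Finset.sum_eq_zero fun c hc => ?_
  rw [if_neg]
  intro e
  have := Finset.card_erase_of_mem hc
  rw [← e] at this
  have hpos : 0 < (w j).card := Finset.card_pos.mpr ⟨c, hc⟩
  omega

/-- `1 + rowOp α` is block-triangular for the (reversed) grading by row size. -/
theorem one_add_rowOp_blockTriangular (u : Fin r → Finset (Fin h)) (α : Fin h → S) :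
    (1 + rowOp u α).BlockTriangular (OrderDual.toDual ∘ fun i => (u i).card) := by
  intro i i' hlt
  have hlt' : (u i).card < (u i').card := hlt
  rw [Matrix.add_apply, rowOp_apply_eq_zero u α hlt'.le, add_zero, Matrix.one_apply, if_neg]
  rintro rfl
  exact lt_irrefl _ hlt'

/-- `1 + colOp b` is block-triangular for the grading by column size. -/
theorem one_add_colOp_blockTriangular (w : Fin r → Finset (Fin h)) (b : Fin h → S) :
    (1 + colOp w b).BlockTriangular (fun j => (w j).card) := by
  intro j' j hlt
  rw [Matrix.add_apply, colOp_apply_eq_zero w b hlt.le, add_zero, Matrix.one_apply, if_neg]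
  rintro rfl
  exact lt_irrefl _ hlt

/-- **`det (1 + rowOp α) = 1`** (block-unipotent). -/
theorem det_one_add_rowOp (u : Fin r → Finset (Fin h)) (α : Fin h → S) : (1 + rowOp u α).det = 1 := by
  classical
  rw [(one_add_rowOp_blockTriangular u α).det]
  refine Finset.prod_eq_one fun k _ => ?_
  have hblock : (1 + rowOp u α).toSquareBlock (OrderDual.toDual ∘ fun i => (u i).card) k = 1 := by
    ext ⟨i, hi⟩ ⟨i', hi'⟩
    have hcard : (u i).card = (u i').card := by
      have e : (OrderDual.toDual ∘ fun i => (u i).card) i = (OrderDual.toDual ∘ fun i => (u i).card) i' :=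
        hi.trans hi'.symm
      simpa using e
    rw [Matrix.toSquareBlock_def, Matrix.of_apply, Matrix.add_apply, rowOp_apply_eq_zero u α hcard.le, add_zero,
      Matrix.one_apply, Matrix.one_apply]
    simp only [Subtype.mk.injEq]
  rw [hblock, Matrix.det_one]

/-- **`det (1 + colOp b) = 1`** (block-unipotent). -/
theorem det_one_add_colOp (w : Fin r → Finset (Fin h)) (b : Fin h → S) : (1 + colOp w b).det = 1 := by
  classical
  rw [(one_add_colOp_blockTriangular w b).det]
  refine Finset.prod_eq_one fun k _ => ?_
  have hblock : (1 + colOp w b).toSquareBlock (fun j => (w j).card) k = 1 := by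
    ext ⟨j', hj'⟩ ⟨j, hj⟩
    have hcard : (w j).card = (w j').card := hj.trans hj'.symm
    rw [Matrix.toSquareBlock_def, Matrix.of_apply, Matrix.add_apply, colOp_apply_eq_zero w b hcard.le, add_zero,
      Matrix.one_apply, Matrix.one_apply]
    simp only [Subtype.mk.injEq]
  rw [hblock, Matrix.det_one]

/-! ## 4. Pure forms are free -/

section Pure

variable (u w : Fin r → Finset (Fin h)) (hu : Function.Injective u) (hw : Function.Injective w)
  (hlu : IsLowerSet (Set.range u)) (hlw : IsLowerSet (Set.range w))

/-- `colOp` with zero coefficients is zero. -/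
theorem colOp_zero : colOp w (fun _ => (0 : S)) = 0 := by
  ext j' j
  simp [colOp]

/-- `rowOp` with zero coefficients is zero. -/
theorem rowOp_zero : rowOp u (fun _ => (0 : S)) = 0 := by
  ext i i'
  simp [rowOp]

include hu hw hlu hlw in
/-- **A pure-`x` affine factor acts by the unipotent row operator**: `pmat (f · (1 + Σ_a α_a x_a)) = (1 + rowOp α) · pmat f`. -/
theorem pmat_mul_pureX (f : MvPolynomial (Fin (h + h)) S) (α : Fin h → S) :
    pmat u w (f * (C 1 + ∑ a, C (α a) * X (Fin.castAdd h a))) = (1 + rowOp u α) * pmat u w f := by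
  have e := pmat_mul_affine u w hu hw hlu hlw f 1 α (fun _ => 0)
  simp only [map_zero, zero_mul, Finset.sum_const_zero, add_zero, colOp_zero, mul_zero, one_smul] at e
  rw [e, Matrix.add_mul, Matrix.one_mul]

include hu hw hlu hlw in
/-- **A pure-`y` affine factor acts by the unipotent column operator**: `pmat (f · (1 + Σ_c b_c y_c)) = pmat f · (1 + colOp b)`. -/
theorem pmat_mul_pureY (f : MvPolynomial (Fin (h + h)) S) (b : Fin h → S) :
    pmat u w (f * (C 1 + ∑ c, C (b c) * X (Fin.natAdd h c))) = pmat u w f * (1 + colOp w b) := by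
  have e := pmat_mul_affine u w hu hw hlu hlw f 1 (fun _ => 0) b
  simp only [map_zero, zero_mul, Finset.sum_const_zero, add_zero, rowOp_zero, one_smul] at e
  rw [e, Matrix.mul_add, Matrix.mul_one]

include hu hw hlu hlw in
/-- **PURE `x`-FORMS ARE FREE**: multiplying a design by `1 + Σ_a α_a x_a` does not change the partition determinant. -/
theorem det_pmat_mul_pureX (f : MvPolynomial (Fin (h + h)) S) (α : Fin h → S) :
    (pmat u w (f * (C 1 + ∑ a, C (α a) * X (Fin.castAdd h a)))).det = (pmat u w f).det := by
  rw [pmat_mul_pureX u w hu hw hlu hlw, Matrix.det_mul, det_one_add_rowOp, one_mul]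

include hu hw hlu hlw in
/-- **PURE `y`-FORMS ARE FREE**: multiplying a design by `1 + Σ_c b_c y_c` does not change the partition determinant. -/
theorem det_pmat_mul_pureY (f : MvPolynomial (Fin (h + h)) S) (b : Fin h → S) :
    (pmat u w (f * (C 1 + ∑ c, C (b c) * X (Fin.natAdd h c)))).det = (pmat u w f).det := by
  rw [pmat_mul_pureY u w hu hw hlu hlw, Matrix.det_mul, det_one_add_colOp, mul_one]

include hu hw hlu hlw in
/-- **Any product of pure `x`-forms is free.** -/
theorem det_pmat_mul_prod_pureX {ι : Type*} (s : Finset ι) (α : ι → Fin h → S)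
    (f : MvPolynomial (Fin (h + h)) S) :
    (pmat u w (f * ∏ k ∈ s, (C 1 + ∑ a, C (α k a) * X (Fin.castAdd h a)))).det = (pmat u w f).det := by
  classical
  induction s using Finset.induction_on generalizing f with
  | empty => rw [Finset.prod_empty, mul_one]
  | insert k s hk ih =>
    rw [Finset.prod_insert hk, ← mul_assoc, ih, det_pmat_mul_pureX u w hu hw hlu hlw]

include hu hw hlu hlw in
/-- **Any product of pure `y`-forms is free.** -/
theorem det_pmat_mul_prod_pureY {ι : Type*} (s : Finset ι) (b : ι → Fin h → S)
    (f : MvPolynomial (Fin (h + h)) S) :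
    (pmat u w (f * ∏ k ∈ s, (C 1 + ∑ c, C (b k c) * X (Fin.natAdd h c)))).det = (pmat u w f).det := by
  classical
  induction s using Finset.induction_on generalizing f with
  | empty => rw [Finset.prod_empty, mul_one]
  | insert k s hk ih =>
    rw [Finset.prod_insert hk, ← mul_assoc, ih, det_pmat_mul_pureY u w hu hw hlu hlw]

include hu hw hlu hlw in
/-- **A design consisting of pure forms only never hits a lower-set layout with at least two rows**: its partition
determinant equals that of the empty product, `det [coeff_{(u i, w j)} 1]`, which vanishes as soon as two distinct
rows exist (the matrix `[u i = ∅ ∧ w j = ∅]` has rank `≤ 1`). -/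
theorem det_pmat_prod_pure_eq_zero {ι κ : Type*} (s : Finset ι) (t : Finset κ) (α : ι → Fin h → S)
    (b : κ → Fin h → S) {i₁ i₂ : Fin r} (hne : i₁ ≠ i₂) :
    (pmat u w ((∏ k ∈ s, (C 1 + ∑ a, C (α k a) * X (Fin.castAdd h a))) *
      ∏ k ∈ t, (C 1 + ∑ c, C (b k c) * X (Fin.natAdd h c)))).det = 0 := by
  classical
  rw [show ((∏ k ∈ s, (C 1 + ∑ a, C (α k a) * X (Fin.castAdd h a))) *
      ∏ k ∈ t, (C 1 + ∑ c, C (b k c) * X (Fin.natAdd h c)) : MvPolynomial (Fin (h + h)) S) =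
      (1 * ∏ k ∈ s, (C 1 + ∑ a, C (α k a) * X (Fin.castAdd h a))) *
        ∏ k ∈ t, (C 1 + ∑ c, C (b k c) * X (Fin.natAdd h c)) by rw [one_mul],
    det_pmat_mul_prod_pureY u w hu hw hlu hlw, det_pmat_mul_prod_pureX u w hu hw hlu hlw]
  -- the partition matrix of `1`: entry `[u i = ∅ ∧ w j = ∅]`; two rows `i₁ ≠ i₂` cannot both be `∅` (injectivity),
  -- and a row with `u i ≠ ∅` is zero.
  have hrow : ∀ i, u i ≠ ∅ → ∀ j, pmat u w (1 : MvPolynomial (Fin (h + h)) S) i j = 0 := by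
    intro i hi j
    rw [pmat_apply, coeff_one, if_neg]
    intro e
    apply hi
    obtain ⟨a, ha⟩ := Finset.nonempty_iff_ne_empty.mpr hi
    have := DFunLike.congr_fun e.symm (Fin.castAdd h a)
    rw [Finsupp.zero_apply,
      Summit.ValiantsHypothesis.ValiantsHypothesis.Theorems.BarrierLever.ProductStateSums.partitionExpo_apply_castAdd,
      if_pos ha] at this
    exact absurd this one_ne_zero
  by_cases h1 : u i₁ = ∅
  · have h2 : u i₂ ≠ ∅ := fun e => hne (hu (h1.trans e.symm))
    exact Matrix.det_eq_zero_of_row_eq_zero i₂ (hrow i₂ h2)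
  · exact Matrix.det_eq_zero_of_row_eq_zero i₁ (hrow i₁ h1)

end Pure

end

end Summit.ValiantsHypothesis.ValiantsHypothesis.Theorems.BarrierLever.ChowShift
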